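import Literature.NumberTheory.ModularForms.LevelSixEtaQExpansions
import Literature.NumberTheory.ModularForms.QExpansionDerivative
import HarnessLib

/-!
# `q`-expansions of the level-6 weight-2 Eisenstein series `aΦ₂ + bΦ₃ + cΦ₆`

Sixth file of the level-6 story of the four-step random walk. For Mathlib's `E₂ = 1 − 24Σσ₁(n)qⁿ`
(`hasSum_qExpansion_E2`) and `δ ≥ 1`, `E₂(δτ) = Σ_{δ∣m} a_{m/δ} qᵐ` (`hasSum_E2_natMul`; the
re-indexing `QExpansionAlgebra.hasSum_smul_qParam_natMul` with `𝕢₁(δτ) = 𝕢_{1/δ}(τ)`), hence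
closed forms for ALL `q`-coefficients of `Φ_δ = E₂ − δE₂(δ·)` and of the modular forms
`phiCombForm a b c = aΦ₂ + bΦ₃ + cΦ₆ ∈ M₂(Γ₀(6))` (`hasSum_phiComb`, `qExpansion_phiCombForm_coeff`;
niceness of level-6 forms is `nice_etaQuotient_of_modularForm` of `LevelSixEtaQExpansions`),
in particular of `gSix = Dt/t` and `hSix = ϑZ/Z` (`DombLevelSixForms.lean`):

  `g^∧ = 1, 6, 6, 42, 6, …`,  `hSix^∧ = −1/6, 0, 4, −12, 12, …`  (`gSixForm_coeff_le_four`,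
  `hSixForm_coeff_le_four`).

## References

* F. Diamond, J. Shurman, *A First Course in Modular Forms*, §1.2 (`E₂(τ) − NE₂(Nτ)`).
  [DiamondShurman2005]
-/

noncomputable section

open UpperHalfPlane hiding I
open Complex Filter Topology Finset EisensteinSeries ModularForm Function ArithmeticFunction
open scoped Real MatrixGroups ModularForm Manifold ArithmeticFunction.sigma

open Literature.NumberTheory.EllipticCurves.ModularForms

namespace Literature.NumberTheory.ModularForms

/-! ### `E₂` and `E₂(δτ)` -/

/-- The `q`-coefficients of `E₂`: `1, −24σ₁(1), −24σ₁(2), …`. [folklore] -/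
def e2Coeff (m : ℕ) : ℂ := if m = 0 then 1 else -24 * σ 1 m

/-- `E₂(τ) = Σ e2Coeff(m) qᵐ`, `q = 𝕢₁(τ)`. [folklore] -/
theorem hasSum_E2_qParam (τ : ℍ) :
    HasSum (fun m : ℕ => e2Coeff m • Periodic.qParam 1 (τ : ℂ) ^ m) (E2 τ) := by
  simpa only [e2Coeff, Periodic.qParam, ofReal_one, div_one] using hasSum_qExpansion_E2 (z := τ)

/-- The `q`-coefficients of `E₂(δτ)`: `a_{m/δ}` when `δ ∣ m`, else `0`. [folklore] -/
def e2NatMulCoeff (δ m : ℕ) : ℂ := if δ ∣ m then e2Coeff (m / δ) else 0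

/-- **`E₂(δτ) = Σ_{δ ∣ m} a_{m/δ} qᵐ`.** [folklore] -/
theorem hasSum_E2_natMul (δ : ℕ) (hδ : 0 < δ) (τ : ℍ) :
    HasSum (fun m : ℕ => e2NatMulCoeff δ m • Periodic.qParam 1 (τ : ℂ) ^ m)
      (E2 (natMulPt δ hδ τ)) := by
  have h0 := hasSum_qExpansion_E2 (z := natMulPt δ hδ τ)
  -- `cexp (2πi δτ) = 𝕢_{1/δ}(τ)`
  have hq : cexp (2 * π * I * ((natMulPt δ hδ τ : ℍ) : ℂ)) = Periodic.qParam (1 / δ) (τ : ℂ) := by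
    rw [coe_natMulPt, Periodic.qParam]
    congr 1
    push_cast
    field_simp
  simp_rw [hq] at h0
  have h1 := QExpansionAlgebra.hasSum_smul_qParam_natMul (a := fun m => (if m = 0 then 1 else -24 * (σ 1 m : ℂ)))
    (n := δ) (H := 1 / δ) hδ.ne' h0
  have hH : (δ : ℝ) * (1 / δ) = 1 := by
    have : (δ : ℝ) ≠ 0 := by exact_mod_cast hδ.ne'
    field_simp
  rw [hH] at h1
  refine h1.congr_fun fun m => ?_
  simp only [e2NatMulCoeff, e2Coeff]

/-! ### `aΦ₂ + bΦ₃ + cΦ₆` -/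

/-- The `q`-coefficients of `Φ_δ = E₂ − δE₂(δ·)`. [folklore] -/
def phiE2Coeff (δ m : ℕ) : ℂ := e2Coeff m - δ * e2NatMulCoeff δ m

/-- `Φ_δ(τ) = Σ phiE2Coeff δ m qᵐ`. [folklore] -/
theorem hasSum_phiE2 (δ : ℕ) (hδ : 0 < δ) (τ : ℍ) :
    HasSum (fun m : ℕ => phiE2Coeff δ m • Periodic.qParam 1 (τ : ℂ) ^ m) (phiE2 δ hδ τ) := by
  have h := (hasSum_E2_qParam τ).sub ((hasSum_E2_natMul δ hδ τ).mul_left (δ : ℂ))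
  refine h.congr_fun fun m => ?_
  simp only [phiE2Coeff, smul_eq_mul]
  ring

/-- The `q`-coefficients of `aΦ₂ + bΦ₃ + cΦ₆`. [folklore] -/
def phiCombCoeff (a b c : ℂ) (m : ℕ) : ℂ :=
  a * phiE2Coeff 2 m + b * phiE2Coeff 3 m + c * phiE2Coeff 6 m

/-- `(aΦ₂ + bΦ₃ + cΦ₆)(τ) = Σ phiCombCoeff a b c m qᵐ`. [folklore] -/
theorem hasSum_phiComb (a b c : ℂ) (τ : ℍ) :
    HasSum (fun m : ℕ => phiCombCoeff a b c m • Periodic.qParam 1 (τ : ℂ) ^ m) (phiComb a b c τ) := by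
  have h := (((hasSum_phiE2 2 (by norm_num) τ).mul_left a).add
    ((hasSum_phiE2 3 (by norm_num) τ).mul_left b)).add ((hasSum_phiE2 6 (by norm_num) τ).mul_left c)
  refine h.congr_fun fun m => ?_
  simp only [phiCombCoeff, smul_eq_mul]
  ring

/-- **The `q`-expansion of `aΦ₂ + bΦ₃ + cΦ₆ ∈ M₂(Γ₀(6))`, coefficientwise.** [folklore] -/
theorem qExpansion_phiCombForm_coeff (a b c : ℂ) (m : ℕ) :
    (qExpansion 1 (phiCombForm a b c)).coeff m = phiCombCoeff a b c m := by
  have hn := nice_etaQuotient_of_modularForm (phiCombForm a b c)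
  exact qExpansion_coeff_eq_of_hasSum hn.1 hn.2.1 hn.2.2 (hasSum_phiComb a b c) m

/-! ### The numbers: `σ₁(1..4)` and the first coefficients of `gSix`, `hSix` -/

/-- `σ₁(1) = 1`, `σ₁(2) = 3`, `σ₁(3) = 4`, `σ₁(4) = 7`. [folklore] -/
theorem sigma_one_values : σ 1 1 = 1 ∧ σ 1 2 = 3 ∧ σ 1 3 = 4 ∧ σ 1 4 = 7 := by
  refine ⟨by decide, by decide, by decide, by decide⟩

/-- `e2Coeff 0..4 = 1, −24, −72, −96, −168`. [folklore] -/
theorem e2Coeff_values : e2Coeff 0 = 1 ∧ e2Coeff 1 = -24 ∧ e2Coeff 2 = -72 ∧ e2Coeff 3 = -96 ∧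
    e2Coeff 4 = -168 := by
  obtain ⟨h1, h2, h3, h4⟩ := sigma_one_values
  simp only [e2Coeff]
  norm_num [h1, h2, h3, h4]

/-- **`gSix^∧(0..4) = 1, 6, 6, 42, 6`.** [folklore] -/
theorem gSixForm_coeff_le_four :
    (qExpansion 1 gSixForm).coeff 0 = 1 ∧ (qExpansion 1 gSixForm).coeff 1 = 6 ∧
      (qExpansion 1 gSixForm).coeff 2 = 6 ∧ (qExpansion 1 gSixForm).coeff 3 = 42 ∧
        (qExpansion 1 gSixForm).coeff 4 = 6 := by
  obtain ⟨h1, h2, h3, h4⟩ := sigma_one_values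
  simp only [gSixForm, qExpansion_phiCombForm_coeff, phiCombCoeff, phiE2Coeff, e2NatMulCoeff, e2Coeff]
  norm_num [h1, h2, h3, h4]

/-- **`hSix^∧(0..4) = −1/6, 0, 4, −12, 12`.** [folklore] -/
theorem hSixForm_coeff_le_four :
    (qExpansion 1 hSixForm).coeff 0 = -1 / 6 ∧ (qExpansion 1 hSixForm).coeff 1 = 0 ∧
      (qExpansion 1 hSixForm).coeff 2 = 4 ∧ (qExpansion 1 hSixForm).coeff 3 = -12 ∧
        (qExpansion 1 hSixForm).coeff 4 = 12 := by
  obtain ⟨h1, h2, h3, h4⟩ := sigma_one_values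
  simp only [hSixForm, qExpansion_phiCombForm_coeff, phiCombCoeff, phiE2Coeff, e2NatMulCoeff, e2Coeff]
  norm_num [h1, h2, h3, h4]

end Literature.NumberTheory.ModularForms

end
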